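import Literature.Computability.Cryptography.InfrastructurePrimitivesFP
import Literature.Computability.Complexity.CodeFPLog
import HarnessLib

/-!
# The walk's label layer: instance guard, validity of labels, and the gap evaluator in `CodeFP`

Topic `Computability/Cryptography`; continues `InfrastructurePrimitivesFP.lean` towards the
`FPSpec` package of `InfrastructureWalkFP.lean` (labels of Hallgren's walk as integer pairs, total
programs, a validity predicate closed under the steps, polynomial code bounds). Theorem-and-definition
file, no named facts. The instance parameter is `d = (D, p)` — the radicand and the precision, coded
`⟨bin D, 1ᵖ⟩` — and everything is guarded by `GoodD D` (`D ≡ 0, 1 (mod 4)` not a square), frozen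
otherwise, so that the closure properties hold for EVERY instance code as `FPSpec` demands:

* `GoodD`, `codeFP_goodD`; the guarded programs `unitG`, `rhoG`, `starG` with `codeFP_unitG`,
  `codeFP_rhoG`, `codeFP_starG`, and their values on genuine data (`rhoG_pr`, `starG_pr`);
* **`ValidL d a`** — on a good instance: `a` codes an ideal-shaped REDUCED quotient; otherwise
  `a = unitG` — with `validL_unit`, **`validL_rho`**, **`validL_star`** (Jozsa 2003 §6.2 Prop. 19,
  §7.1: `ρ` and `*` map reduced principal ideals to reduced ideals) and the code bound
  `length_le_of_validL` (`|P| ≤ D`, `Q ≤ 2D + 1`);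
* the gap evaluator **`gIntG d a = lnQuadDyadic P Q D p p`** (`CodeFPLog.lean`), `codeFP_gIntG`, its
  guarantee `abs_log_val_sub_gIntG_le` (`|log ψ(a) − gIntG/2ᵖ| ≤ 2/2ᵖ` on valid labels of a good
  instance — Jozsa §9 Thm. 5: the distances `ln γ` "to sufficient accuracy") and the code bound
  `length_gIntG_le`.

## References

* R. Jozsa, arXiv:quant-ph/0302134 (2003), §6.2 Prop. 19, §7.1 Prop. 35, §9 Thm. 5. [Jozsa2003]
* S. Arora, B. Barak, *Computational Complexity: A Modern Approach*, CUP 2009, §1.3. [AroraBarak2009]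
-/

noncomputable section

open scoped Classical

namespace Literature.Computability.Cryptography

namespace InfraPrimitives

open Literature.NumberTheory.QuadraticFields Literature.NumberTheory.QuadraticFields.QuadIrr
  Literature.Computability.Complexity Literature.Computability.Complexity.CodeFP Polynomial
  Literature.Computability.Complexity.LogFP HallgrenComposition

variable {D : ℕ}

/-! ### The instance guard -/

/-- **Good instances**: `D` is not a square and `D ≡ 0, 1 (mod 4)`. [cite: Jozsa2003, §2 (discriminant D)] -/
def GoodD (D : ℕ) : Prop := ¬ IsSquare D ∧ (D % 4 = 0 ∨ D % 4 = 1)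

/-- The code of an instance `d = (D, p)`: `⟨bin D, 1ᵖ⟩`. [folklore] -/
abbrev dE : ℕ × ℕ → List Bool := pairE natE unE

/-- **The instance guard is computable.** [folklore] -/
theorem codeFP_goodD : CodeFP natE bitE (fun D => decide (GoodD D)) := by
  have h1 : CodeFP natE bitE (fun D => !decide (Nat.sqrt D * Nat.sqrt D = D)) :=
    ((natEq.comp ((natMul.comp (natSqrt.pair natSqrt)).pair (CodeFP.id natE))).not :)
  have h4 : CodeFP natE natE (fun D => D % 4) := (natMod.comp ((CodeFP.id natE).pair (const _ (4 : ℕ))) :)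
  have h2 : CodeFP natE bitE (fun D => decide (D % 4 = 0)) := (natEq.comp (h4.pair (const _ (0 : ℕ))) :)
  have h3 : CodeFP natE bitE (fun D => decide (D % 4 = 1)) := (natEq.comp (h4.pair (const _ (1 : ℕ))) :)
  refine ((h1.and (h2.or h3)).congr fun D => ?_)
  have hsq : ¬ IsSquare D ↔ Nat.sqrt D * Nat.sqrt D ≠ D := by
    rw [Ne, ← Nat.exists_mul_self D]
    constructor
    · rintro h ⟨n, hn⟩; exact h ⟨n, hn.symm⟩
    · rintro h ⟨n, hn⟩; exact h ⟨n, hn.symm⟩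
  unfold GoodD
  rw [hsq]
  by_cases ha : Nat.sqrt D * Nat.sqrt D = D <;> by_cases hb : D % 4 = 0 <;> by_cases hc : D % 4 = 1 <;>
    simp [ha, hb, hc]

/-! ### The guarded programs -/

/-- The unit label: `x₁` on a good instance, the dummy `(1, 1)` otherwise. [cite: JacobsonWilliams2008, §5.3 (5.32)] -/
def unitG (D : ℕ) : ℤ × ℤ := if GoodD D then unitI D else (1, 1)

/-- The guarded baby step. [cite: Jozsa2003, §9 (ρ)] -/
def rhoG (D : ℕ) (a : ℤ × ℤ) : ℤ × ℤ := if GoodD D then rhoI D a else a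

/-- The guarded giant step. [cite: Jozsa2003, §7.1 (I * J)] -/
def starG (D : ℕ) (a b : ℤ × ℤ) : ℤ × ℤ := if GoodD D then starI D a b else a

/-- `unitG = pr x₁` on a good instance. [folklore] -/
theorem unitG_eq (h : GoodD D) : unitG D = pr (QuadIrr.principalFirst D) := by
  unfold unitG; rw [if_pos h, unitI_eq]

/-- `rhoG = step` on quotients with `Q > 0` of a good instance. [folklore] -/
theorem rhoG_pr (h : GoodD D) {x : QuadIrr D} (hQ : 0 < x.Q) : rhoG D (pr x) = pr (step x) := by
  unfold rhoG; rw [if_pos h, rhoI_pr hQ]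

/-- `starG = reduce ∘ comp` on ideal-shaped quotients of a good instance. [folklore] -/
theorem starG_pr (h : GoodD D) {x y : QuadIrr D} (hx : x.IsIdealShaped) (hy : y.IsIdealShaped) :
    starG D (pr x) (pr y) = pr (reduce (HallgrenComposition.comp x y)) := by
  unfold starG; rw [if_pos h, starI_pr h.1 h.2 hx hy]

/-- **The unit label is computable.** [folklore] -/
theorem codeFP_unitG : CodeFP natE qE unitG := by
  refine ((codeFP_goodD.ite codeFP_unitI (const _ ((1 : ℤ), (1 : ℤ)))).congr fun D => ?_)
  unfold unitG; by_cases h : GoodD D <;> simp [h]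

/-- **The guarded baby step is computable.** [cite: Jozsa2003, §9 Thm. 5] -/
theorem codeFP_rhoG : CodeFP cE qE (fun c => rhoG c.1 c.2) := by
  refine (((codeFP_goodD.comp (fst _ _)).ite codeFP_rhoI (snd _ _)).congr fun c => ?_)
  unfold rhoG; by_cases h : GoodD c.1 <;> simp [h]

/-- **The guarded giant step is computable.** [cite: Jozsa2003, §7.1 Prop. 35] -/
theorem codeFP_starG : CodeFP (pairE natE (pairE qE qE)) qE (fun c => starG c.1 c.2.1 c.2.2) := by
  refine (((codeFP_goodD.comp (fst _ _)).ite codeFP_starI (snd _ _).fst').congr fun c => ?_)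
  unfold starG; by_cases h : GoodD c.1 <;> simp [h]

/-! ### Valid labels -/

/-- The quotient of a pair. [folklore] -/
abbrev qi (D : ℕ) (a : ℤ × ℤ) : QuadIrr D := ⟨a.1, a.2⟩

/-- `pr (qi a) = a`. [folklore] -/
@[simp] theorem pr_qi (a : ℤ × ℤ) : pr (qi D a) = a := rfl

/-- **Valid labels**: on a good instance, ideal-shaped reduced quotients; otherwise only the dummy
unit. [cite: Jozsa2003, §6.2 (reduced principal ideals)] -/
def ValidL (D : ℕ) (a : ℤ × ℤ) : Prop :=
  if GoodD D then (qi D a).IsIdealShaped ∧ (qi D a).IsReduced else a = unitG D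

/-- Valid labels of a good instance are ideal-shaped reduced quotients. [folklore] -/
theorem validL_iff (h : GoodD D) (a : ℤ × ℤ) : ValidL D a ↔ (qi D a).IsIdealShaped ∧ (qi D a).IsReduced := by
  unfold ValidL; rw [if_pos h]

/-- `δ = (σ, 2)` is ideal-shaped on a good instance. [cite: Jozsa2003, §5 Prop. 16 (the unit ideal)] -/
theorem isIdealShaped_principalStart (h : GoodD D) : (QuadIrr.principalStart D).IsIdealShaped := by
  refine ⟨by show (0 : ℤ) < 2; norm_num, ⟨1, rfl⟩, ?_⟩
  show 2 * (2 : ℤ) ∣ (((D % 2 : ℕ) : ℤ)) ^ 2 - D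
  have hsq : (((D % 2 : ℕ) : ℤ)) ^ 2 = ((D % 2 : ℕ) : ℤ) := by
    rcases Nat.mod_two_eq_zero_or_one D with h0 | h0 <;> simp [h0]
  rw [hsq]
  rcases h.2 with h4 | h4 <;> omega

/-- **The unit label is valid.** [cite: Jozsa2003, §6.3 Thm. 4 (the principal cycle starts at 𝒪)] -/
theorem validL_unit (D : ℕ) : ValidL D (unitG D) := by
  unfold ValidL
  by_cases h : GoodD D
  · rw [if_pos h, unitG_eq h]
    have hred := isReduced_principalFirst h.1 h.2
    refine ⟨?_, hred⟩
    show (step (QuadIrr.principalStart D)).IsIdealShaped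
    rw [step_eq_stepWith]
    refine isIdealShaped_stepWith (isIdealShaped_principalStart h) _ ?_
    rw [← step_eq_stepWith]
    exact hred.1
  · rw [if_neg h]

/-- **The baby step preserves validity.** [cite: Jozsa2003, §6.2 Prop. 19 (ρ(I) is reduced)] -/
theorem validL_rho (D : ℕ) (a : ℤ × ℤ) (ha : ValidL D a) : ValidL D (rhoG D a) := by
  unfold ValidL at ha ⊢
  by_cases h : GoodD D
  · rw [if_pos h] at ha ⊢
    obtain ⟨hsh, hred⟩ := ha
    rw [show a = pr (qi D a) from rfl, rhoG_pr h hred.1]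
    exact ⟨isIdealShaped_step h.1 hsh hred, isReduced_step h.1 hred⟩
  · rw [if_neg h] at ha ⊢
    unfold rhoG; rw [if_neg h, ha]

/-- **The giant step preserves validity.** [cite: Jozsa2003, §7.1 (I * J is a reduced principal ideal)] -/
theorem validL_star (D : ℕ) (a b : ℤ × ℤ) (ha : ValidL D a) (hb : ValidL D b) : ValidL D (starG D a b) := by
  unfold ValidL at ha hb ⊢
  by_cases h : GoodD D
  · rw [if_pos h] at ha hb ⊢
    obtain ⟨hsa, -⟩ := ha
    obtain ⟨hsb, -⟩ := hb
    rw [show a = pr (qi D a) from rfl, show b = pr (qi D b) from rfl, starG_pr h hsa hsb]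
    have hc := isIdealShaped_comp h.2 hsa hsb
    exact ⟨isIdealShaped_reduce h.1 hc, isReduced_reduce h.1 hc.isAdmissible (comp_Q_pos h.2 hsa hsb)⟩
  · rw [if_neg h] at ha ⊢
    unfold starG; rw [if_neg h, ha]

/-- **Valid labels are small**: `|P| ≤ D` and `|Q| ≤ 2D + 1`. [cite: JacobsonWilliams2008, §3.3 (3.32)] -/
theorem natAbs_le_of_validL {a : ℤ × ℤ} (ha : ValidL D a) : a.1.natAbs ≤ 2 * D + 1 ∧ a.2.natAbs ≤ 2 * D + 1 := by
  unfold ValidL at ha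
  by_cases h : GoodD D
  · rw [if_pos h] at ha
    obtain ⟨h1, -, h3⟩ := IsReduced.size ha.2
    exact ⟨by simpa using (le_trans h1 (by omega : D ≤ 2 * D + 1)), h3⟩
  · rw [if_neg h] at ha
    subst ha
    unfold unitG; rw [if_neg h]; simp

/-- The code of a valid label has length `≤ 9 size D + 26`. [folklore] -/
theorem length_le_of_validL {a : ℤ × ℤ} (ha : ValidL D a) : (qE a).length ≤ 9 * D.size + 26 := by
  obtain ⟨h1, h2⟩ := natAbs_le_of_validL ha
  have h := length_qE_le h1 h2
  have hs : (2 * D + 1).size ≤ D.size + 2 := by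
    have : 2 * D + 1 < 2 ^ (D.size + 2) := by
      have := Nat.lt_size_self D
      calc 2 * D + 1 < 2 * 2 ^ D.size + 2 * 2 ^ D.size := by omega
        _ = 2 ^ (D.size + 2) := by ring
    exact Nat.size_le.mpr this
  omega

/-! ### The gap evaluator -/

/-- **The gap evaluator**: `2ᵖ log ((P + √D)/Q)` to within `2`, by `lnQuadDyadic` (guarded: `0` off
good instances or non-positive data). [cite: Jozsa2003, §9 Thm. 5 (ln γ to sufficient accuracy)] -/
def gIntG (d : ℕ × ℕ) (a : ℤ × ℤ) : ℤ :=
  if GoodD d.1 ∧ 0 < a.1 ∧ 0 < a.2 then lnQuadDyadic a.1.toNat a.2.toNat d.1 d.2 d.2 else 0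

/-- **The gap evaluator is computable.** [cite: Jozsa2003, §9 Thm. 5] -/
theorem codeFP_gIntG : CodeFP (pairE dE qE) intE (fun c => gIntG c.1 c.2) := by
  have hD : CodeFP (pairE dE qE) natE (fun c => c.1.1) := (fst _ _).fst'
  have hp : CodeFP (pairE dE qE) unE (fun c => c.1.2) := (fst _ _).snd'
  have hP : CodeFP (pairE dE qE) intE (fun c => c.2.1) := (snd _ _).fst'
  have hQ : CodeFP (pairE dE qE) intE (fun c => c.2.2) := (snd _ _).snd'
  have hg : CodeFP (pairE dE qE) bitE (fun c => decide (GoodD c.1.1) && (decide ((0 : ℤ) < c.2.1) &&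
      decide ((0 : ℤ) < c.2.2))) :=
    (codeFP_goodD.comp hD).and (((intLt.comp ((const _ (0 : ℤ)).pair hP) :)).and
      ((intLt.comp ((const _ (0 : ℤ)).pair hQ) :)))
  have hl : CodeFP (pairE dE qE) intE (fun c => lnQuadDyadic c.2.1.toNat c.2.2.toNat c.1.1 c.1.2 c.1.2) :=
    (codeFP_lnQuadDyadic.comp ((intToNat.comp hP).pair ((intToNat.comp hQ).pair (hD.pair (hp.pair hp)))) :)
  refine ((hg.ite hl (const _ (0 : ℤ))).congr fun c => ?_)
  unfold gIntG
  by_cases h1 : GoodD c.1.1 <;> by_cases h2 : (0 : ℤ) < c.2.1 <;> by_cases h3 : (0 : ℤ) < c.2.2 <;> simp [h1, h2, h3]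

/-- **Accuracy of the gap evaluator** on valid labels of a good instance:
`|log ψ(a) − gIntG (D, p) a / 2ᵖ| ≤ 2/2ᵖ`. [cite: Jozsa2003, §9 Thm. 5] -/
theorem abs_log_val_sub_gIntG_le {p : ℕ} (h : GoodD D) {a : ℤ × ℤ} (ha : ValidL D a) :
    |Real.log (qi D a).val - (gIntG (D, p) a : ℝ) / 2 ^ p| ≤ 2 / (2 : ℝ) ^ p := by
  rw [validL_iff h] at ha
  obtain ⟨-, hred⟩ := ha
  have hP : 0 < a.1 := hred.P_pos
  have hQ : 0 < a.2 := hred.1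
  have h5 : 5 ≤ D := five_le h.1 h.2
  unfold gIntG
  rw [if_pos ⟨h, hP, hQ⟩]
  have key := abs_log_quad_sub_lnQuadDyadic_le (P := a.1.toNat) (Q := a.2.toNat) (D := D)
    (by omega) (by omega) p p
  have hv : (qi D a).val = ((a.1.toNat : ℕ) + Real.sqrt D) / (a.2.toNat : ℕ) := by
    unfold val
    have e1 : ((a.1.toNat : ℕ) : ℝ) = (a.1 : ℝ) := by exact_mod_cast Int.toNat_of_nonneg hP.le
    have e2 : ((a.2.toNat : ℕ) : ℝ) = (a.2 : ℝ) := by exact_mod_cast Int.toNat_of_nonneg hQ.le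
    rw [e1, e2]
  rw [hv]
  calc _ ≤ 1 / (2 : ℝ) ^ p + 1 / (2 : ℝ) ^ p := key
    _ = 2 / (2 : ℝ) ^ p := by ring

/-- `log t < size t` for a natural number `t ≥ 1`. [folklore] -/
theorem log_lt_size {t : ℕ} (ht : 1 ≤ t) : Real.log t < t.size := by
  have h1 : (t : ℝ) < 2 ^ t.size := by exact_mod_cast Nat.lt_size_self t
  have h2 : Real.log t < t.size * Real.log 2 := by
    rw [← Real.log_pow]  -- hmm: log (2^size)
    exact Real.log_lt_log (by exact_mod_cast ht) (by exact_mod_cast Nat.lt_size_self t)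
  have h3 : Real.log 2 ≤ 1 := by
    have := Real.log_two_lt_d9; linarith
  have h4 : (0 : ℝ) ≤ t.size := Nat.cast_nonneg _
  nlinarith

/-- **Size of the gap evaluator** on valid labels: `|gIntG (D, p) a| ≤ 2ᵖ (size (2D+1) + 3)`, hence a
code of length `≤ 3 (p + size D) + 20`. [folklore] -/
theorem length_gIntG_le (d : ℕ × ℕ) {a : ℤ × ℤ} (ha : ValidL d.1 a) :
    (intE (gIntG d a)).length ≤ 3 * (d.2 + d.1.size) + 20 := by
  obtain ⟨D, p⟩ := d
  show (intE (gIntG (D, p) a)).length ≤ 3 * (p + D.size) + 20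
  by_cases hg : GoodD D ∧ 0 < a.1 ∧ 0 < a.2
  · obtain ⟨h, hP, hQ⟩ := hg
    have hacc := abs_log_val_sub_gIntG_le (p := p) h ha
    rw [validL_iff h] at ha
    obtain ⟨-, hred⟩ := ha
    -- `0 < log ψ < log (2√D) ≤ size (2D+1)`
    have hv1 : 1 < (qi D a).val := hred.2.2.1
    have hv2 : (qi D a).val < 2 * Real.sqrt D := by
      have h1 := hred.P_lt_sqrt
      have h2 : (1 : ℝ) ≤ (qi D a).Q := by exact_mod_cast hred.1
      have hpos : 0 < (qi D a).P + Real.sqrt D := by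
        have := hred.P_pos; have : (0 : ℝ) < (qi D a).P := by exact_mod_cast this
        positivity
      unfold val
      calc ((qi D a).P + Real.sqrt D) / (qi D a).Q ≤ ((qi D a).P + Real.sqrt D) / 1 :=
            div_le_div_of_nonneg_left hpos.le one_pos h2
        _ < 2 * Real.sqrt D := by rw [div_one]; linarith
    have hsD : 2 * Real.sqrt D ≤ (2 * D + 1 : ℕ) := by
      have hD1 : (1 : ℝ) ≤ D := by exact_mod_cast le_trans (by norm_num) (five_le h.1 h.2)
      have : Real.sqrt D ≤ (D : ℝ) := Real.sqrt_le_iff.mpr ⟨by positivity, by nlinarith⟩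
      push_cast; linarith
    have hlog0 : 0 < Real.log (qi D a).val := Real.log_pos hv1
    have hlog1 : Real.log (qi D a).val < ((2 * D + 1).size : ℝ) := by
      have := Real.log_lt_log (by linarith) (hv2.trans_le hsD)
      exact this.trans (log_lt_size (by omega))
    -- `|g| ≤ 2ᵖ (size + 3)`
    set g := gIntG (D, p) a with hgdef
    have h2p : (0 : ℝ) < (2 : ℝ) ^ p := by positivity
    have hgR : |(g : ℝ)| ≤ 2 ^ p * (((2 * D + 1).size : ℝ) + 3) := by
      have h1 : |(g : ℝ) / 2 ^ p| ≤ |Real.log (qi D a).val| + 2 / 2 ^ p := by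
        have := abs_sub_abs_le_abs_sub ((g : ℝ) / 2 ^ p) (Real.log (qi D a).val)
        rw [abs_sub_comm] at hacc
        linarith
      rw [abs_div, abs_of_pos h2p, div_le_iff₀ h2p] at h1
      have h2 : |Real.log (qi D a).val| < ((2 * D + 1).size : ℝ) := by
        rw [abs_of_pos hlog0]; exact hlog1
      have h3 : (2 : ℝ) / 2 ^ p * 2 ^ p = 2 := by field_simp
      have h4 : |(g : ℝ)| ≤ |Real.log (qi D a).val| * 2 ^ p + 2 := by rw [add_mul, h3] at h1; exact h1
      have h5 : |Real.log (qi D a).val| * 2 ^ p ≤ ((2 * D + 1).size : ℝ) * 2 ^ p :=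
        mul_le_mul_of_nonneg_right h2.le h2p.le
      have h6 : (1 : ℝ) ≤ 2 ^ p := one_le_pow₀ (by norm_num)
      nlinarith
    have hgN : g.natAbs ≤ 2 ^ p * ((2 * D + 1).size + 3) := by
      have : (g.natAbs : ℝ) ≤ 2 ^ p * (((2 * D + 1).size : ℝ) + 3) := by
        rw [Nat.cast_natAbs, Int.cast_abs]; exact hgR
      exact_mod_cast this
    have hs1 : (2 * D + 1).size ≤ D.size + 2 := by
      refine Nat.size_le.mpr ?_
      have := Nat.lt_size_self D
      calc 2 * D + 1 < 2 * 2 ^ D.size + 2 * 2 ^ D.size := by omega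
        _ = 2 ^ (D.size + 2) := by ring
    have hs2 : g.natAbs.size ≤ p + (D.size + 5).size := by
      refine (Nat.size_le_size hgN).trans ?_
      rw [mul_comm]
      refine (size_mul_two_pow_le _ _).trans ?_
      have : ((2 * D + 1).size + 3).size ≤ (D.size + 5).size := Nat.size_le_size (by omega)
      omega
    have hs3 : (D.size + 5).size ≤ D.size + 5 := Nat.size_le.mpr (Nat.lt_two_pow_self)
    have := length_intE_le g
    omega
  · unfold gIntG
    rw [if_neg hg]
    show (intE 0).length ≤ _
    have : (intE 0).length ≤ 2 := by decide
    omega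
  where
  /-- `size (m · 2^e) ≤ size m + e`. [folklore] -/
  size_mul_two_pow_le (m e : ℕ) : (m * 2 ^ e).size ≤ m.size + e := by
    rcases Nat.eq_zero_or_pos m with rfl | hm
    · simp
    · rw [← Nat.shiftLeft_eq, Nat.size_shiftLeft (by omega)]

end InfraPrimitives

end Literature.Computability.Cryptography

end
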